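import Summits.Ventures.PercRepro.RankLevelSetNullitySplitK

/-!
# PercRepro — THE NULLITY SPLIT ON THE `Y`-SIDE: the sets of rank `≤ 7` when a set of rank `≤ 7` carries nullity `≥ d − i`
(p8, gen 21; a feeder for S4 — the top of the `q = 7` window, the rows `43` and below)

When some `X ⊆ E` of rank `≤ 7` has `r(X) + d ≤ |X| + i` (nullity `≥ d − i`), every set `Y` of rank `≤ 7` has
`|Y ∖ X| ≤ 7 + i` (`|Y ∪ X| ≤ r(Y ∪ X) + d ≤ r(Y) + r(X) + d ≤ 7 + |X| + i`, `ncard_sdiff_le_of_eRk_le`), so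
`Y ↦ (Y ∩ X, Y ∖ X)` injects the sets of rank `≤ 7` into `𝒫(X) × {J ⊆ E ∖ X : |J| ≤ 7 + i}`:
`#{Y : r(Y) ≤ 7} ≤ 2^{|X|}·Σ_{j ≤ 7 + i} C(n − |X|, j)` — and this is monotone in `|X|` (`two_pow_mul_sum_choose_mono`, Pascal:
`Σ_{j ≤ t} C(N + 1, j) ≤ 2·Σ_{j ≤ t} C(N, j)`), so with `|X| ≤ 7 + d − i`:
**`ncard_eRk_le_le_of_nullity_ge`**: `#{Y : r(Y) ≤ 7} ≤ 2^{7 + d − i}·Σ_{j ≤ 7 + i} C(n − (7 + d − i), j)`.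
The core RankLevelSetCoreSevenOfFormSplitKY uses it as the `Y`-tail of the case-`i` branches. Axioms: standard.
-/

open scoped Matroid

namespace PercRepro

namespace ThmN

open Set

variable {α : Type}

/-- Pascal, exactly: `Σ_{j ≤ t} C(N + 1, j) + C(N, t) = 2·Σ_{j ≤ t} C(N, j)`. -/
theorem sum_choose_succ_add_eq (N t : ℕ) :
    ∑ j ∈ Finset.range (t + 1), (N + 1).choose j + N.choose t = 2 * ∑ j ∈ Finset.range (t + 1), N.choose j := by
  induction t with
  | zero => simp
  | succ t ih =>
    rw [Finset.sum_range_succ, Finset.sum_range_succ (fun j => N.choose j), Nat.choose_succ_succ']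
    omega

/-- Pascal: `Σ_{j ≤ t} C(N + 1, j) ≤ 2·Σ_{j ≤ t} C(N, j)`. -/
theorem sum_choose_succ_le_two_mul (N t : ℕ) :
    ∑ j ∈ Finset.range (t + 1), (N + 1).choose j ≤ 2 * ∑ j ∈ Finset.range (t + 1), N.choose j := by
  have := sum_choose_succ_add_eq N t
  omega

/-- `s ↦ 2^s·Σ_{j ≤ t} C(n − s, j)` is monotone on `s ≤ n`. -/
theorem two_pow_mul_sum_choose_mono (n t : ℕ) {s s' : ℕ} (hss : s ≤ s') (hs' : s' ≤ n) :
    2 ^ s * ∑ j ∈ Finset.range (t + 1), (n - s).choose j ≤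
      2 ^ s' * ∑ j ∈ Finset.range (t + 1), (n - s').choose j := by
  induction s', hss using Nat.le_induction with
  | base => exact le_rfl
  | succ s' hss' ih =>
    refine (ih (by omega)).trans ?_
    have h := sum_choose_succ_le_two_mul (n - (s' + 1)) t
    rw [show n - (s' + 1) + 1 = n - s' by omega] at h
    calc 2 ^ s' * ∑ j ∈ Finset.range (t + 1), (n - s').choose j
        ≤ 2 ^ s' * (2 * ∑ j ∈ Finset.range (t + 1), (n - (s' + 1)).choose j) := Nat.mul_le_mul_left _ h
      _ = 2 ^ (s' + 1) * ∑ j ∈ Finset.range (t + 1), (n - (s' + 1)).choose j := by ring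

/-- If `X` has nullity `≥ d − i` then every set `Y` of rank `≤ 7` has `|Y ∖ X| ≤ 7 + i`. -/
theorem ncard_sdiff_le_of_eRk_le (M : Matroid α) [M.Finite] {d i : ℕ}
    (hd : M.E.encard = M.eRank + d) {X : Set α} (hX : X ⊆ M.E) (hnul : M.eRk X + d ≤ (X.ncard : ℕ∞) + i)
    {Y : Set α} (hY : Y ⊆ M.E) (hYr : M.eRk Y ≤ 7) : (Y \ X).ncard ≤ 7 + i := by
  have hXfin : X.Finite := M.ground_finite.subset hX
  have hYfin : Y.Finite := M.ground_finite.subset hY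
  have hU : Y ∪ X ⊆ M.E := Set.union_subset hY hX
  have hUfin : (Y ∪ X).Finite := hYfin.union hXfin
  have hsub := M.eRk_union_le_eRk_add_eRk Y X
  have hcap := PercRepro.Matroid.encard_le_eRk_add_of_encard_eq hU hd
  have hneX : M.eRk X ≠ ⊤ := ((M.eRk_le_encard _).trans_lt hXfin.encard_lt_top).ne
  have hneY : M.eRk Y ≠ ⊤ := ((M.eRk_le_encard _).trans_lt hYfin.encard_lt_top).ne
  have hneU : M.eRk (Y ∪ X) ≠ ⊤ := ((M.eRk_le_encard _).trans_lt hUfin.encard_lt_top).ne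
  obtain ⟨r, hr⟩ := ENat.ne_top_iff_exists.1 hneX
  obtain ⟨s, hs⟩ := ENat.ne_top_iff_exists.1 hneY
  obtain ⟨u, hu⟩ := ENat.ne_top_iff_exists.1 hneU
  rw [← hr] at hnul hsub
  rw [← hs] at hYr hsub
  rw [← hu] at hsub hcap
  rw [← hUfin.cast_ncard_eq] at hcap
  have e1 : u ≤ s + r := by exact_mod_cast hsub
  have e2 : (Y ∪ X).ncard ≤ u + d := by exact_mod_cast hcap
  have e3 : r + d ≤ X.ncard + i := by exact_mod_cast hnul
  have e4 : s ≤ 7 := by exact_mod_cast hYr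
  have e5 : (Y ∪ X).ncard = (Y \ X).ncard + X.ncard := by
    rw [← Set.ncard_union_eq Set.disjoint_sdiff_left (hYfin.sdiff) hXfin, Set.sdiff_union_self]
  omega

/-- **The sets of rank `≤ 7` when a set of rank `≤ 7` carries nullity `≥ d − i`**:
`#{Y : r(Y) ≤ 7} ≤ 2^{7 + d − i}·Σ_{j ≤ 7 + i} C(n − (7 + d − i), j)` (for `|X| ≤ 7 + d − i`). -/
theorem ncard_eRk_le_le_of_nullity_ge (M : Matroid α) [M.Finite] {d i : ℕ}
    (hd : M.E.encard = M.eRank + d) {X : Set α} (hX : X ⊆ M.E) (hnul : M.eRk X + d ≤ (X.ncard : ℕ∞) + i)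
    (hXs : X.ncard ≤ 7 + d - i) (hn7 : 7 + d - i ≤ M.E.ncard) :
    {Y : Set α | Y ⊆ M.E ∧ M.eRk Y ≤ 7}.ncard ≤
      2 ^ (7 + d - i) * ∑ j ∈ Finset.range (7 + i + 1), (M.E.ncard - (7 + d - i)).choose j := by
  classical
  have hXfin : X.Finite := M.ground_finite.subset hX
  set J := {J : Set α | J ⊆ M.E \ X ∧ J.ncard ≤ 7 + i} with hJ
  have hJfin : J.Finite := (M.ground_finite.sdiff).finite_subsets.subset fun J hJ => hJ.1
  have hmaps : ∀ Y ∈ {Y : Set α | Y ⊆ M.E ∧ M.eRk Y ≤ 7}, (Y ∩ X, Y \ X) ∈ (𝒫 X) ×ˢ J := by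
    intro Y hY
    refine ⟨Set.inter_subset_right, ?_, ncard_sdiff_le_of_eRk_le M hd hX hnul hY.1 hY.2⟩
    exact Set.sdiff_subset_sdiff_left hY.1
  have hinj : Set.InjOn (fun Y => (Y ∩ X, Y \ X)) {Y : Set α | Y ⊆ M.E ∧ M.eRk Y ≤ 7} := by
    intro Y _ Y' _ h
    simp only [Prod.mk.injEq] at h
    rw [← Set.inter_union_sdiff Y X, ← Set.inter_union_sdiff Y' X, h.1, h.2]
  have hcard := Set.ncard_le_ncard_of_injOn (fun Y => (Y ∩ X, Y \ X)) hmaps hinj (hXfin.powerset.prod hJfin)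
  rw [Set.ncard_prod, Set.ncard_powerset X hXfin] at hcard
  have hJle : J.ncard ≤ ∑ j ∈ Finset.range (7 + i + 1), (M.E \ X).ncard.choose j :=
    ncard_subsets_card_le_le (M.E \ X) (M.ground_finite.sdiff) (7 + i)
  have hEX : (M.E \ X).ncard = M.E.ncard - X.ncard := Set.ncard_sdiff hX hXfin
  rw [hEX] at hJle
  calc {Y : Set α | Y ⊆ M.E ∧ M.eRk Y ≤ 7}.ncard ≤ 2 ^ X.ncard * J.ncard := hcard
    _ ≤ 2 ^ X.ncard * ∑ j ∈ Finset.range (7 + i + 1), (M.E.ncard - X.ncard).choose j :=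
        Nat.mul_le_mul_left _ hJle
    _ ≤ 2 ^ (7 + d - i) * ∑ j ∈ Finset.range (7 + i + 1), (M.E.ncard - (7 + d - i)).choose j := by
        exact two_pow_mul_sum_choose_mono M.E.ncard (7 + i) hXs hn7

end ThmN

end PercRepro
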